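import Summits.CriticalPhenomena.PercolationContinuityZ3.Theorems.PercNearOneGluingNoHeavyQuantDepthTwoRelayCap
import Summits.CriticalPhenomena.PercolationContinuityZ3.Theorems.PercNearOneGluingNoHeavyQuantDepthTwoRelayTilt
import Summits.CriticalPhenomena.PercolationContinuityZ3.Theorems.PercNearOneGluingNoHeavyQuantDepthTwoRelayNewTop
import Summits.CriticalPhenomena.PercolationContinuityZ3.Theorems.PercNearOneGluingNoHeavyQuantSliceTwoRowRates
import HarnessLib

/-!
# QUANT lane R8, SGC in the RELAY case: THE ONE-ROW PRINCIPLE, pointwise (part 1) — the pull-back of a product price system along the relay,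
# and (C1): the pulled-back charges are nonnegative on the factor non-lows

builds on p205010 (kernel theorem, internal audit signed; external expert review pending)

Support file (`--supports stmt-CriticalPhenomena-4575`), QUANT lane seat prim-quant-arm-2 (gen 39); memo
`run/shared/lean/prim/quant/prim-quant-arm-2-g39/ONE-ROW-PRINCIPLE-G39.md`.  Theorems only, standard axioms, no sorries.

SETTING.  Factor target `T`, floor `0 < y < 1` (`u = y/(1−y)`), relay partner `{0: 1−g, 1: g}` with `y ≤ g ≤ 1`, product layer `j ≤ M`, product target
`T′ = T + g` on `{0..M+1}`.  A (clipped) PRICE SYSTEM of the product at layer `j`: `a′ ≥ 0` on the product lows (`l ≤ j`, `2l < T′`), `β′ ≥ 0`, with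
`a′ l ≤ usage_{y,T′,j}(l,h)·β′ h` on every valid pair — the data of the dual of `LawDec.FlowAtT y T′ j (M+1) ν` (`…QuantLawDecStrongDuality`).  Row
coefficients `C′ = a′` on lows, `−β′` elsewhere; PULL-BACK `e(a) = (1−g)C′(a) + gC′(a+1)`.  LAYER RULE: `j* = j − 1` when every product price is
`≤ u·(−e j)` (the pulled-back charge at `j` covers a factor giant), else `j* = j`.

RESULTS (this file).  Bookkeeping on the product charges (`prod_charge_mid`, `prod_charge_giant`, `usage_cell_le`), the pull-back on the factor lows
(`relay_pull_low_a/b`), and (C1) `relay_onerow_nonneg`: `−e ≥ 0` on the factor non-lows of layer `j*`.  Part 2 (`…QuantRelayOneRowPairs`) proves the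
pair constraints (C2) `e l ≤ usage_{y,T,j*}(l,h)·(−e h)`, so that `(e⁺, −e)` IS a factor price system at layer `j*` (ONE factor dual row dominates the
pulled-back product row; exact census of the memo ≈ 1.5 M instances / 0); the duality assembly (`FlowAtT` of the factor at layers `j−1`, `j` ⟹
`FlowAtT` of the relay product at layer `j`) is `…QuantRelayOneRowFlow`.
HONEST STATUS: SGC, D2, G₁ (general), `Quant.FarTreeRow` (light) remain OPEN; nothing here is cited as a published result; the lane's RATE class
log\* and honest sentence (`run/shared/lean/prim/quant/README.md`) are unchanged.

[this work]; (B) `relay_cap_pairGate`: prim-quant-census-2 g67; usage / pairGate / duality: prim-quant-stmt g22, prim-quant-census-2 g54 (this lane).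
The gluing rows served [cite: KozmaNitzan2024, Conjecture 3 (p. 15)]; product measure [cite: Grimmett1999, §1.3 p. 10].
-/

noncomputable section

namespace Summit.CriticalPhenomena.PercolationContinuityZ3.Theorems

namespace Quant

open Finset

namespace LawDec

/-! ### Bookkeeping on the product price system -/

/-- a product charge below the layer dominates price × clipped capacity: `m ≤ j`, `2m < T′`, `h ≤ j`, `m < h`, pair constraint ⟹
`a′ m · max 0 (1/pairGate y T′ m h − 1) ≤ β′ h` (`0 < y < 1`, `β′ h ≥ 0`). [this work] -/
theorem prod_charge_mid (y T' : ℝ) (j M m h : ℕ) (a' β' : ℕ → ℝ) (hy0 : 0 < y) (hy1 : y < 1)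
    (hb0 : 0 ≤ β' h)
    (hpair : ∀ l h, l ≤ j → 2 * (l : ℝ) < T' → h ≤ M + 1 → (j + 1 ≤ h ∨ T' < (l : ℝ) + h) → a' l ≤ usage y T' j l h * β' h)
    (hm : m ≤ j) (hlow : 2 * (m : ℝ) < T') (hhj : h ≤ j) (hhM : h ≤ M + 1) (hmh : m < h) :
    a' m * max 0 (1 / pairGate y T' m h - 1) ≤ β' h := by
  by_cases hc : T' < (m : ℝ) + h
  · have hG0 : 0 < pairGate y T' m h := pairGate_pos y T' m h hlow hmh
    have hG1 : pairGate y T' m h < 1 := pairGate_lt_one y T' m h hy0 hy1 hlow hc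
    have hcap : 0 ≤ 1 / pairGate y T' m h - 1 := by
      rw [sub_nonneg, le_div_iff₀ hG0]; linarith
    rw [max_eq_right hcap]
    have hp := hpair m h hm hlow hhM (Or.inr hc)
    have hnj : ¬ (j + 1 ≤ h) := by omega
    simp only [usage, gateOf, if_neg hnj] at hp
    -- `a′ ≤ (G/(1−G))·β′` ⟹ `a′(1/G − 1) ≤ β′`
    rw [show 1 / pairGate y T' m h - 1 = (1 - pairGate y T' m h) / pairGate y T' m h by field_simp]
    rw [show a' m * ((1 - pairGate y T' m h) / pairGate y T' m h) = a' m * (1 - pairGate y T' m h) / pairGate y T' m h by ring,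
      div_le_iff₀ hG0]
    have : a' m * (1 - pairGate y T' m h) ≤ pairGate y T' m h / (1 - pairGate y T' m h) * β' h * (1 - pairGate y T' m h) :=
      mul_le_mul_of_nonneg_right hp (by linarith)
    have h1G : 1 - pairGate y T' m h ≠ 0 := (by linarith : 0 < 1 - pairGate y T' m h).ne'
    have e : pairGate y T' m h / (1 - pairGate y T' m h) * β' h * (1 - pairGate y T' m h) = β' h * pairGate y T' m h := by
      field_simp
    linarith [e]
  · -- not compatible: the clipped capacity vanishes
    have hρ : 1 ≤ (T' - 2 * (m : ℝ)) / ((h : ℝ) - m) := by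
      have hd : (0 : ℝ) < (h : ℝ) - m := by
        have : (m : ℝ) < h := by exact_mod_cast hmh
        linarith
      rw [le_div_iff₀ hd]; linarith [not_lt.1 hc]
    have hG : 1 ≤ pairGate y T' m h := le_trans hρ (le_max_left _ _)
    have hcap : 1 / pairGate y T' m h - 1 ≤ 0 := by
      rw [sub_nonpos, div_le_one (by linarith)]; exact hG
    rw [max_eq_left hcap, mul_zero]; exact hb0

/-- a product GIANT charge dominates every price: `h ≥ j+1`, `h ≤ M+1`, `m` a product low ⟹ `a′ m ≤ (y/(1−y))·β′ h`. [this work] -/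
theorem prod_charge_giant (y T' : ℝ) (j M m h : ℕ) (a' β' : ℕ → ℝ)
    (hpair : ∀ l h, l ≤ j → 2 * (l : ℝ) < T' → h ≤ M + 1 → (j + 1 ≤ h ∨ T' < (l : ℝ) + h) → a' l ≤ usage y T' j l h * β' h)
    (hm : m ≤ j) (hlow : 2 * (m : ℝ) < T') (hhj : j + 1 ≤ h) (hhM : h ≤ M + 1) :
    a' m ≤ y / (1 - y) * β' h := by
  have hp := hpair m h hm hlow hhM (Or.inl hhj)
  rwa [usage_giant_eq y T' j m h hhj] at hp

/-- **the relay cell is cheap**: `T ≤ 2h`, `h + 1 ≤ j`, `y ≤ g < 1`, `0 < y < 1` ⟹ `usage_{y,T+g,j}(h, h+1) ≤ g/(1−g)`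
(its `ρ = T + g − 2h ≤ g`, so its minimal gate is `≤ g`). [this work] -/
theorem usage_cell_le (y T g : ℝ) (j h : ℕ) (hy0 : 0 < y) (hy1 : y < 1) (hyg : y ≤ g) (hg1 : g < 1)
    (htop : T ≤ 2 * (h : ℝ)) (hhj : h + 1 ≤ j) :
    usage y (T + g) j h (h + 1) ≤ g / (1 - g) := by
  have hn : ¬ (j + 1 ≤ h + 1) := by omega
  simp only [usage, gateOf, if_neg hn]
  have hGg : pairGate y (T + g) h (h + 1) ≤ g := by
    unfold pairGate
    have e : (T + g - 2 * (h : ℝ)) / (((h + 1 : ℕ) : ℝ) - h) = T + g - 2 * (h : ℝ) := by push_cast; ring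
    rw [e]
    calc max (T + g - 2 * (h : ℝ)) (y ^ 2 + (1 - y) * (T + g - 2 * (h : ℝ)))
        ≤ max g (y ^ 2 + (1 - y) * g) := gateFun_mono hy1.le (by linarith)
      _ = g := max_eq_left (by nlinarith [mul_nonneg hy0.le (sub_nonneg.2 hyg)])
  have hG1 : pairGate y (T + g) h (h + 1) < 1 := lt_of_le_of_lt hGg hg1
  rw [div_le_div_iff₀ (by linarith) (by linarith)]
  nlinarith

/-! ### The pull-back on the lows of the factor -/

/-- **pull-back price, case (a)**: both `l` and `l + 1` are product lows ⟹ `e l = (1−g)·a′ l + g·a′ (l+1)`. [this work] -/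
theorem relay_pull_low_a (T' g : ℝ) (j l : ℕ) (a' β' Cp e : ℕ → ℝ)
    (hCp : ∀ h : ℕ, Cp h = if h ≤ j ∧ 2 * (h : ℝ) < T' then a' h else -β' h)
    (he : ∀ a : ℕ, e a = (1 - g) * Cp a + g * Cp (a + 1))
    (hl : l + 1 ≤ j) (hlow : 2 * ((l : ℝ) + 1) < T') :
    e l = (1 - g) * a' l + g * a' (l + 1) := by
  rw [he l, hCp l, hCp (l + 1), if_pos ⟨by omega, by linarith⟩, if_pos ⟨hl, by push_cast; exact hlow⟩]

/-- **pull-back price, case (b)**: `l` a product low with `l + 1 ≤ j` but `l + 1` NOT a product low (`T + g ≤ 2(l+1)`), `2l < T`, `0 < y < 1`,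
`y ≤ g ≤ 1` ⟹ `e l ≤ min(1−g, (T−2l)/(T−2l+g)) · a′ l` (the cell `(l, l+1)` refunds `g·(1/σ − 1)·a′ l` when `σ = T + g − 2l < 1`). [this work] -/
theorem relay_pull_low_b (y T g : ℝ) (j M l : ℕ) (a' β' Cp e : ℕ → ℝ) (hy0 : 0 < y) (hy1 : y < 1) (hyg : y ≤ g)
    (ha0 : ∀ l, 0 ≤ a' l) (hb0 : ∀ h, 0 ≤ β' h)
    (hpair : ∀ l h, l ≤ j → 2 * (l : ℝ) < T + g → h ≤ M + 1 → (j + 1 ≤ h ∨ T + g < (l : ℝ) + h) →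
      a' l ≤ usage y (T + g) j l h * β' h)
    (hCp : ∀ h : ℕ, Cp h = if h ≤ j ∧ 2 * (h : ℝ) < T + g then a' h else -β' h)
    (he : ∀ a : ℕ, e a = (1 - g) * Cp a + g * Cp (a + 1))
    (hjM : j ≤ M) (hl : l + 1 ≤ j) (hlow : 2 * (l : ℝ) < T) (hnot : T + g ≤ 2 * ((l : ℝ) + 1)) :
    e l ≤ min (1 - g) ((T - 2 * (l : ℝ)) / (T - 2 * (l : ℝ) + g)) * a' l := by
  have hg0 : 0 < g := lt_of_lt_of_le hy0 hyg
  have hs : 0 < T - 2 * (l : ℝ) := by linarith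
  have hσ : 0 < T - 2 * (l : ℝ) + g := by linarith
  rw [he l, hCp l, hCp (l + 1), if_pos ⟨by omega, by linarith⟩,
    if_neg (fun h => by have := h.2; push_cast at this; linarith)]
  by_cases hc : T + g < (l : ℝ) + ((l + 1 : ℕ) : ℝ)
  · -- the cell `(l, l+1)` is a compatible product mid: it refunds `g·(1/σ − 1)`, leaving exactly `s/σ`
    have hc' : T + g - 2 * (l : ℝ) < 1 := by push_cast at hc; linarith
    have hρ : y ≤ (T + g - 2 * (l : ℝ)) / (((l + 1 : ℕ) : ℝ) - l) := by
      have e : (T + g - 2 * (l : ℝ)) / (((l + 1 : ℕ) : ℝ) - l) = T + g - 2 * (l : ℝ) := by push_cast; ring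
      rw [e]; linarith
    have hβ := prod_charge_mid y (T + g) j M l (l + 1) a' β' hy0 hy1 (hb0 (l + 1)) hpair (by omega) (by linarith) hl
      (by omega) (by omega)
    have hG : pairGate y (T + g) l (l + 1) = T + g - 2 * (l : ℝ) := by
      rw [pairGate_eq_rho_of_le y (T + g) l (l + 1) hy0.le hρ]; push_cast; ring
    have hσ' : 0 < T + g - 2 * (l : ℝ) := by linarith
    have hcap : 0 ≤ 1 / (T + g - 2 * (l : ℝ)) - 1 := by
      rw [sub_nonneg, le_div_iff₀ hσ']; linarith
    rw [hG, max_eq_right hcap] at hβ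
    -- `e l = (1−g) a′ − g β′(l+1) ≤ (1−g)a′ − g a′ (1/σ − 1) = (s/σ) a′`
    have hmin : min (1 - g) ((T - 2 * (l : ℝ)) / (T - 2 * (l : ℝ) + g)) = (T - 2 * (l : ℝ)) / (T - 2 * (l : ℝ) + g) := by
      refine min_eq_right ?_
      rw [div_le_iff₀ hσ]; nlinarith
    rw [hmin]
    have e1 : (T - 2 * (l : ℝ)) / (T - 2 * (l : ℝ) + g) * a' l = (1 - g) * a' l - g * (a' l * (1 / (T + g - 2 * (l : ℝ)) - 1)) := by
      rw [show T - 2 * (l : ℝ) + g = T + g - 2 * (l : ℝ) by ring]; field_simp; ring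
    rw [e1]; nlinarith [mul_le_mul_of_nonneg_left hβ hg0.le]
  · -- not compatible (`σ ≥ 1`): `e l ≤ (1−g) a′ = min(…)·a′`
    have hσ1 : 1 ≤ T - 2 * (l : ℝ) + g := by push_cast at hc; linarith
    have hmin : min (1 - g) ((T - 2 * (l : ℝ)) / (T - 2 * (l : ℝ) + g)) = 1 - g := by
      refine min_eq_left ?_
      rw [le_div_iff₀ hσ]; nlinarith
    rw [hmin]
    have h0 := ha0 l
    nlinarith [hb0 (l + 1), h0]

/-! ### (C1) the pulled-back charges are nonnegative on the factor non-lows -/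

/-- **(C1)** With the layer rule in either branch, `−e h ≥ 0` for every factor atom `h ≤ M` that is not a factor low of layer `j*`
(`¬(h ≤ j* ∧ 2h < T)`). [this work] -/
theorem relay_onerow_nonneg (y T g : ℝ) (j js M : ℕ) (a' β' Cp e : ℕ → ℝ)
    (hy0 : 0 < y) (hy1 : y < 1) (hyg : y ≤ g) (hg1 : g ≤ 1) (hjM : j ≤ M)
    (ha0 : ∀ l, 0 ≤ a' l) (hb0 : ∀ h, 0 ≤ β' h)
    (hpair : ∀ l h, l ≤ j → 2 * (l : ℝ) < T + g → h ≤ M + 1 → (j + 1 ≤ h ∨ T + g < (l : ℝ) + h) →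
      a' l ≤ usage y (T + g) j l h * β' h)
    (hCp : ∀ h : ℕ, Cp h = if h ≤ j ∧ 2 * (h : ℝ) < T + g then a' h else -β' h)
    (he : ∀ a : ℕ, e a = (1 - g) * Cp a + g * Cp (a + 1))
    (hjs : (js + 1 = j ∧ ∀ l, l ≤ j → 2 * (l : ℝ) < T + g → a' l ≤ y / (1 - y) * (-e j)) ∨ js = j)
    (h : ℕ) (hhM : h ≤ M) (hnl : ¬ (h ≤ js ∧ 2 * (h : ℝ) < T)) :
    0 ≤ -e h := by
  have hg0 : 0 < g := lt_of_lt_of_le hy0 hyg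
  have h1y : 0 < 1 - y := by linarith
  have hu0 : 0 < y / (1 - y) := div_pos hy0 h1y
  have hjs_le : js ≤ j := by rcases hjs with ⟨h1, _⟩ | h1 <;> omega
  by_cases hpl : h ≤ j ∧ 2 * (h : ℝ) < T + g
  · -- `h` is a product low but not a factor low of layer `j*`
    rcases Nat.lt_or_ge js h with hjsh | hjsh
    · -- `h = j`, branch `j* = j − 1`: the layer rule itself
      rcases hjs with ⟨hjs1, hrule⟩ | hjs2
      · have hhj : h = j := by omega
        subst hhj
        have := hrule h le_rfl hpl.2
        have : 0 ≤ y / (1 - y) * (-e h) := le_trans (ha0 h) this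
        exact (mul_nonneg_iff_of_pos_left hu0).1 this
      · omega
    · -- a new top low: `T ≤ 2h < T + g`, `h ≤ j*`
      have htop : T ≤ 2 * (h : ℝ) := by
        by_contra hlt; exact hnl ⟨hjsh, not_le.1 hlt⟩
      rw [he h, hCp h, hCp (h + 1), if_pos hpl,
        if_neg (fun hc => by have := hc.2; push_cast at this; linarith)]
      by_cases hc : T + g < (h : ℝ) + ((h + 1 : ℕ) : ℝ)
      · rcases Nat.lt_or_ge h j with hhj | hhj
        · -- the cell `(h, h+1)` is a cheap mid
          rcases lt_or_eq_of_le hg1 with hg1' | hg1'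
          · have hp := hpair h (h + 1) hpl.1 hpl.2 (by omega) (Or.inr hc)
            have hU := usage_cell_le y T g j h hy0 hy1 hyg hg1' htop (by omega)
            have hUn : 0 ≤ usage y (T + g) j h (h + 1) :=
              (usage_pos_of_compat y (T + g) j h (h + 1) hy0 hy1 hpl.2 (by omega) (Or.inr hc)).le
            have h1 : a' h ≤ g / (1 - g) * β' (h + 1) :=
              le_trans hp (mul_le_mul_of_nonneg_right hU (hb0 (h + 1)))
            have h1g : 0 < 1 - g := by linarith
            have h2 : (1 - g) * a' h ≤ g * β' (h + 1) := by
              have := mul_le_mul_of_nonneg_left h1 h1g.le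
              rw [show (1 - g) * (g / (1 - g) * β' (h + 1)) = g * β' (h + 1) by field_simp] at this
              exact this
            linarith
          · -- `g = 1`
            subst hg1'
            have := hb0 (h + 1)
            linarith
        · -- `h = j`: the next atom is the product giant `j + 1`
          have hhj' : h = j := le_antisymm hpl.1 hhj
          have hp := prod_charge_giant y (T + g) j M h (h + 1) a' β' hpair hpl.1 hpl.2 (by omega) (by omega)
          -- `(1−g) a′ ≤ g β′(j+1)` since `g ≥ y` gives `(1−g)·u⁻¹… `: from `a′ ≤ u β′`, `(1−g) u ≤ g`
          have hgu : (1 - g) * (y / (1 - y)) ≤ g := by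
            rw [mul_div_assoc', div_le_iff₀ h1y]; nlinarith
          nlinarith [mul_le_mul_of_nonneg_left hp (by linarith : (0:ℝ) ≤ 1 - g), mul_nonneg hu0.le (hb0 (h + 1)),
            mul_le_mul_of_nonneg_right hgu (hb0 (h + 1))]
      · -- not compatible: `g = 1`, `T = 2h`
        have hc' := not_lt.1 hc
        push_cast at hc'
        have hg1' : g = 1 := by linarith
        subst hg1'
        have := hb0 (h + 1)
        linarith
  · -- `h` is not a product low: both copies are charges
    have hpl1 : ¬ (h + 1 ≤ j ∧ 2 * (((h + 1 : ℕ) : ℝ)) < T + g) := by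
      rintro ⟨h1, h2⟩
      push_cast at h2
      apply hpl
      exact ⟨by omega, by linarith⟩
    rw [he h, hCp h, hCp (h + 1), if_neg hpl, if_neg hpl1]
    nlinarith [hb0 h, hb0 (h + 1)]

end LawDec

end Quant

end Summit.CriticalPhenomena.PercolationContinuityZ3.Theorems
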